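import Mathlib
import Summits.ValiantsHypothesis.ValiantsHypothesis.Theorems.BarrierLeverPartitionMinorsHitByVPSimplexJoinUniform
import Summits.ValiantsHypothesis.ValiantsHypothesis.Theorems.BarrierLeverPartitionMinorsHitByVPSimplexJoinUniformSimplex

/-!
# Route BarrierLever — item `PartitionMinorsHitByVP` (stmt-ValiantsHypothesis-19717):
# the SIMPLEX-ONLY design — every layout of size `r ≤ (2h)²·((2h)²+1)` is hit (`b = 10`), hence ALL layouts for `3 ≤ h ≤ 21`

Helper file (`--supports stmt-ValiantsHypothesis-19717`; cell valiant-natproofs, rung V4, 𝒟-side door (c), line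
`hidden_states`, uniform-menu lane; prover seat val-np-p3 gen 12). Definition-free apart from the explicit design. Closes NO item.

THE POINT. In the exact-support (simplex-product) door the budget is `m ≤ (2h)²` pieces, each with slots of `≤ (2h)²` options.
A piece with ONE slot is a simplex (`…SimplexJoinUniformSimplex.uniform_of_singleSlot`: simplices are uniform), and uniform
pieces compose (`…SimplexJoinUniform.good_of_uniform_pieces`, `partitionMinor_hit_of_uniformPieces`). So the design
«`⌈r/((2h)²+1)⌉` simplices, filled greedily» (`simplexDesign`) serves EVERY injective row family as long as
`r ≤ (2h)²·((2h)²+1) = 16h⁴ + 4h²` — with no arithmetic on the row families at all.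

* `simplexDesign`, `simplexLive`, `simplexDesign_injective`, `simplexDesign_live` — the design and its exact-range property;
* `simplexDesign_uniform` — every piece is uniform (one slot);
* **`simplexUniversal_of_le_quartic`** — the body of the node `SimplexJoin.Stmt.simplexUniversal` at `(h, r)` for every
  `r ≤ (2h)²((2h)²+1)` (no lower-set or largeness hypothesis);
* **`partitionMinor_hit_of_le_quartic`** — the item's conclusion for every injective layout `(u, w)` of size
  `r ≤ (2h)²((2h)²+1)`, `h ≥ 3`, inside `SmallCircuits ℂ (h+h) 10`;
* **`partitionMinor_hit_upto_twentyone`** — since `2^h ≤ (2h)²((2h)²+1)` for `h ≤ 21`, EVERY injective layout is hit for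
  `3 ≤ h ≤ 21` (`b = 10`). The wide join door's all-`u` cells stop at `h = 18` (`…HubWide.universalJoinWide_upto_eighteen`,
  open window `h = 19, 289 561 ≤ r ≤ 524 284`); through the simplex door the first `h` with an open `r` is `h = 22`
  (`r > 3 750 032`).

WHAT THIS IS NOT: polynomial range only (`r ≤ 16h⁴ + 4h²`); nothing on the all-`h` nodes, on crux 14610 or on VP ≠ VNP;
item 19717 stays OPEN.
-/

set_option linter.dupNamespace false

namespace Summit.ValiantsHypothesis.ValiantsHypothesis.Theorems.BarrierLever.SimplexJoin

open Finset Matrix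
open Literature.Barriers.ValiantsHypothesis

noncomputable section

/-! ## The design: `⌈r/(N+1)⌉` single-slot pieces, column `k ↦ (k / (N+1), k % (N+1))` -/

/-- Number of simplex pieces: `⌈r/(N+1)⌉ = (r + N)/(N+1)`. -/
def numPieces (N r : ℕ) : ℕ := (r + N) / (N + 1)

/-- The piece index of a column is in range. -/
theorem div_lt_numPieces {N r : ℕ} (k : Fin r) : k.val / (N + 1) < numPieces N r := by
  unfold numPieces
  have hk := k.isLt
  have hr : r + N = (r - 1) + (N + 1) := by omega
  rw [hr, Nat.add_div_right _ (by omega : 0 < N + 1)]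
  exact Nat.lt_succ_of_le (Nat.div_le_div_right (by omega))

/-- The option index of a non-base column is in range. -/
theorem mod_pred_lt {N r : ℕ} (k : Fin r) (hk : k.val % (N + 1) ≠ 0) : k.val % (N + 1) - 1 < N := by
  have := Nat.mod_lt k.val (by omega : 0 < N + 1)
  omega

/-- The simplex-only design: column `k` sits in piece `k / (N+1)` with slot pattern `none` if `k % (N+1) = 0` and
`some (k % (N+1) − 1)` otherwise (one slot, `D = 1`). -/
def simplexDesign (N r : ℕ) (k : Fin r) : Fin (numPieces N r) × (Fin 1 → Option (Fin N)) :=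
  (⟨k.val / (N + 1), div_lt_numPieces k⟩,
    fun _ => if hk : k.val % (N + 1) = 0 then none else some ⟨k.val % (N + 1) - 1, mod_pred_lt k hk⟩)

/-- The live option sets: piece `p` offers option `j` iff the column `p·(N+1) + j + 1` exists (`< r`). -/
def simplexLive (N r : ℕ) (p : Fin (numPieces N r)) (_f : Fin 1) : Finset (Fin N) :=
  Finset.univ.filter fun j => p.val * (N + 1) + (j.val + 1) < r

/-- The piece of column `k` is `k / (N+1)`. -/
theorem simplexDesign_fst (N r : ℕ) (k : Fin r) : ((simplexDesign N r k).1 : ℕ) = k.val / (N + 1) := rfl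

/-- Base columns (`k % (N+1) = 0`) have the empty pattern. -/
theorem simplexDesign_snd_of_zero (N r : ℕ) (k : Fin r) (f : Fin 1) (hk : k.val % (N + 1) = 0) :
    (simplexDesign N r k).2 f = none := by
  simp [simplexDesign, hk]

/-- Non-base columns use option `k % (N+1) − 1`. -/
theorem simplexDesign_snd_of_ne (N r : ℕ) (k : Fin r) (f : Fin 1) (hk : k.val % (N + 1) ≠ 0) :
    (simplexDesign N r k).2 f = some ⟨k.val % (N + 1) - 1, mod_pred_lt k hk⟩ := by
  simp [simplexDesign, hk]

/-- The design is injective (a column is determined by its piece and its slot pattern). -/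
theorem simplexDesign_injective (N r : ℕ) : Function.Injective (simplexDesign N r) := by
  intro k k' hkk'
  have h1 : k.val / (N + 1) = k'.val / (N + 1) := by
    have := congrArg (fun c => (c.1 : ℕ)) hkk'
    simpa [simplexDesign_fst] using this
  have h2 : k.val % (N + 1) = k'.val % (N + 1) := by
    have hs := congrFun (congrArg Prod.snd hkk') 0
    by_cases hk : k.val % (N + 1) = 0
    · by_cases hk' : k'.val % (N + 1) = 0
      · rw [hk, hk']
      · rw [simplexDesign_snd_of_zero N r k 0 hk, simplexDesign_snd_of_ne N r k' 0 hk'] at hs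
        exact absurd hs (by simp)
    · by_cases hk' : k'.val % (N + 1) = 0
      · rw [simplexDesign_snd_of_ne N r k 0 hk, simplexDesign_snd_of_zero N r k' 0 hk'] at hs
        exact absurd hs (by simp)
      · rw [simplexDesign_snd_of_ne N r k 0 hk, simplexDesign_snd_of_ne N r k' 0 hk'] at hs
        have := Fin.mk.inj (Option.some.inj hs)
        omega
  apply Fin.ext
  rw [← Nat.div_add_mod k.val (N + 1), ← Nat.div_add_mod k'.val (N + 1), h1, h2]

/-- Exact range: a pattern `(p, g)` is a column iff every option it uses is live. -/
theorem simplexDesign_live (N r : ℕ) (c : Fin (numPieces N r) × (Fin 1 → Option (Fin N))) :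
    c ∈ Set.range (simplexDesign N r) ↔ ∀ (f : Fin 1) (j : Fin N), c.2 f = some j → j ∈ simplexLive N r c.1 f := by
  constructor
  · rintro ⟨k, rfl⟩ f j hj
    simp only [simplexLive, Finset.mem_filter, Finset.mem_univ, true_and, simplexDesign_fst]
    by_cases hk : k.val % (N + 1) = 0
    · rw [simplexDesign_snd_of_zero N r k f hk] at hj; exact absurd hj (by simp)
    · rw [simplexDesign_snd_of_ne N r k f hk] at hj
      have hj' : (j : ℕ) = k.val % (N + 1) - 1 := by
        have := Option.some.inj hj
        rw [← this]
      have hk2 := k.isLt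
      have hdm : k.val / (N + 1) * (N + 1) + k.val % (N + 1) = k.val := Nat.div_add_mod' k.val (N + 1)
      have hpos : 0 < k.val % (N + 1) := Nat.pos_of_ne_zero hk
      have hj1 : j.val + 1 = k.val % (N + 1) := by rw [hj']; omega
      rw [hj1]
      omega
  · intro hc
    obtain ⟨p, g⟩ := c
    have hp : p.val * (N + 1) + 1 ≤ r := by
      have hp' := p.isLt
      unfold numPieces at hp'
      have h2 : (p.val + 1) * (N + 1) ≤ r + N := (Nat.le_div_iff_mul_le (by omega : 0 < N + 1)).mp hp'
      rw [add_one_mul] at h2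
      omega
    rcases hg : g 0 with _ | j
    · -- the `none` column of piece `p`
      refine ⟨⟨p.val * (N + 1), by omega⟩, ?_⟩
      have hmod : p.val * (N + 1) % (N + 1) = 0 := Nat.mul_mod_left _ _
      refine Prod.ext ?_ (funext fun f => ?_)
      · apply Fin.ext
        simp only [simplexDesign_fst]
        rw [Nat.mul_div_cancel _ (by omega : 0 < N + 1)]
      · obtain rfl : f = 0 := Subsingleton.elim _ _
        change (simplexDesign N r _).2 0 = g 0
        rw [simplexDesign_snd_of_zero N r _ 0 hmod, hg]
    · -- the column `p·(N+1) + j + 1`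
      have hj : j ∈ simplexLive N r p 0 := hc 0 j hg
      simp only [simplexLive, Finset.mem_filter, Finset.mem_univ, true_and] at hj
      refine ⟨⟨p.val * (N + 1) + (j.val + 1), hj⟩, ?_⟩
      have hjN : j.val + 1 < N + 1 := by have := j.isLt; omega
      have hmod : (p.val * (N + 1) + (j.val + 1)) % (N + 1) = j.val + 1 := by
        rw [Nat.mul_add_mod_of_lt hjN]
      have hdiv : (p.val * (N + 1) + (j.val + 1)) / (N + 1) = p.val := by
        rw [Nat.add_comm, Nat.add_mul_div_right _ _ (by omega : 0 < N + 1), Nat.div_eq_of_lt hjN, Nat.zero_add]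
      refine Prod.ext ?_ (funext fun f => ?_)
      · apply Fin.ext
        simp only [simplexDesign_fst]
        exact hdiv
      · have hne : (p.val * (N + 1) + (j.val + 1)) % (N + 1) ≠ 0 := by rw [hmod]; omega
        obtain rfl : f = 0 := Subsingleton.elim _ _
        change (simplexDesign N r _).2 0 = g 0
        rw [simplexDesign_snd_of_ne N r _ 0 hne, hg]
        congr 1
        apply Fin.ext
        simp [hmod]

/-- Every piece of the simplex-only design is uniform (one slot: `uniform_of_singleSlot`). -/
theorem simplexDesign_uniform (h N r : ℕ) (p : Fin (numPieces N r)) (n : ℕ) (c : Fin n → Fin r)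
    (hc : Function.Injective c) (hcp : ∀ x, (simplexDesign N r (c x)).1 = p)
    (_hsurj : ∀ k, (simplexDesign N r k).1 = p → ∃ x, c x = k)
    (v : Fin n → Finset (Fin h)) (hv : Function.Injective v) :
    ∃ t : Option (Fin 1 × Fin N) → Fin h → ℂ,
      (Matrix.of fun x x' : Fin n => ∏ a ∈ v x,
        (t none a + ∑ f : Fin 1, ((simplexDesign N r (c x')).2 f).elim 0 fun j => t (some (f, j)) a)).det ≠ 0 :=
  uniform_of_singleSlot h (numPieces N r) 1 N r (simplexDesign N r) (simplexDesign_injective N r) p n c hc hcp 0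
    (fun _ f hf => absurd (Subsingleton.elim f 0) hf) v hv

/-- The piece count is within budget: `r ≤ X·(N+1) ⇒ ⌈r/(N+1)⌉ ≤ X`. -/
theorem numPieces_le {N r X : ℕ} (hr : r ≤ X * (N + 1)) : numPieces N r ≤ X := by
  unfold numPieces
  have : (r + N) / (N + 1) < X + 1 := by
    rw [Nat.div_lt_iff_lt_mul (Nat.succ_pos N)]
    nlinarith
  omega

/-! ## The node body and the item's conclusion in the polynomial range -/

/-- **The body of `Stmt.simplexUniversal` at `(h, r)` for every `r ≤ (2h)²·((2h)²+1)`**: the simplex-only design is good for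
EVERY injective row family. -/
theorem simplexUniversal_of_le_quartic (h r : ℕ) (hr : r ≤ (h + h) ^ 2 * ((h + h) ^ 2 + 1)) :
    ∃ (m D N : ℕ) (S : Fin m → Fin D → Finset (Fin N)) (e : Fin r → Fin m × (Fin D → Option (Fin N))),
      m ≤ (h + h) ^ 2 ∧ D ≤ h + h ∧ N ≤ (h + h) ^ 2 ∧ Function.Injective e ∧
      (∀ c : Fin m × (Fin D → Option (Fin N)),
        c ∈ Set.range e ↔ ∀ (f : Fin D) (j : Fin N), c.2 f = some j → j ∈ S c.1 f) ∧
      ∀ u : Fin r → Finset (Fin h), Function.Injective u →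
        ∃ tx : Fin m → Option (Fin D × Fin N) → Fin h → ℂ,
          (Matrix.of fun i k : Fin r => ∏ a ∈ u i,
            (tx (e k).1 none a + ∑ f : Fin D, ((e k).2 f).elim 0 fun j => tx (e k).1 (some (f, j)) a)).det ≠ 0 := by
  rcases Nat.eq_zero_or_pos h with rfl | hh
  · -- h = 0: then r = 0 and the empty design works
    have hr0 : r = 0 := by simpa using hr
    subst hr0
    refine ⟨0, 0, 0, fun p => p.elim0, fun k => k.elim0, le_rfl, le_rfl, le_rfl, fun k => k.elim0, ?_, ?_⟩
    · intro c; exact c.1.elim0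
    · intro u _
      exact ⟨fun p => p.elim0, by rw [Matrix.det_isEmpty]; exact one_ne_zero⟩
  set N := (h + h) ^ 2 with hN
  refine ⟨numPieces N r, 1, N, simplexLive N r, simplexDesign N r, numPieces_le hr, by omega, le_rfl,
    simplexDesign_injective N r, simplexDesign_live N r, fun u hu => ?_⟩
  exact good_of_uniform_pieces h (numPieces N r) 1 N r u (simplexDesign N r) hu (simplexDesign_injective N r)
    (fun p n c hc hcp hsurj v hv => simplexDesign_uniform h N r p n c hc hcp hsurj v hv)

/-- **The item's conclusion in the polynomial range.** For `h ≥ 3` and every injective layout `(u, w)` of size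
`r ≤ (2h)²·((2h)²+1) = 16h⁴ + 4h²`, some `F ∈ SmallCircuits ℂ (h+h) 10` has a nonsingular layout matrix. -/
theorem partitionMinor_hit_of_le_quartic (h r : ℕ) (hh : 3 ≤ h) (hr : r ≤ (h + h) ^ 2 * ((h + h) ^ 2 + 1))
    (u w : Fin r → Finset (Fin h)) (hu : Function.Injective u) (hw : Function.Injective w) :
    ∃ F ∈ SmallCircuits ℂ (h + h) 10,
      (Matrix.of fun i j : Fin r => MvPolynomial.coeff
        (∑ a ∈ u i, Finsupp.single (Fin.castAdd h a) 1 +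
          ∑ c ∈ w j, Finsupp.single (Fin.natAdd h c) 1) F).det ≠ 0 := by
  set N := (h + h) ^ 2 with hN
  exact partitionMinor_hit_of_uniformPieces h (numPieces N r) 1 N r hh (numPieces_le hr) (by omega) le_rfl u w hu hw
    (simplexLive N r) (simplexDesign N r) (simplexDesign_injective N r) (simplexDesign_live N r)
    (fun p n c hc hcp hsurj v hv => simplexDesign_uniform h N r p n c hc hcp hsurj v hv)

/-- `2^h ≤ (2h)²·((2h)²+1)` for `1 ≤ h ≤ 21` (and not for `h = 22`: `4 194 304 > 3 750 032`). -/
theorem two_pow_le_quartic (h : ℕ) (h1 : 1 ≤ h) (h21 : h ≤ 21) : 2 ^ h ≤ (h + h) ^ 2 * ((h + h) ^ 2 + 1) := by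
  interval_cases h <;> norm_num

/-- **Every injective layout is hit for `3 ≤ h ≤ 21`** (`b = 10`, simplex-only design): an injective family of subsets of
`Fin h` has `r ≤ 2^h ≤ 16h⁴ + 4h²` members. -/
theorem partitionMinor_hit_upto_twentyone (h r : ℕ) (hh : 3 ≤ h) (h21 : h ≤ 21)
    (u w : Fin r → Finset (Fin h)) (hu : Function.Injective u) (hw : Function.Injective w) :
    ∃ F ∈ SmallCircuits ℂ (h + h) 10,
      (Matrix.of fun i j : Fin r => MvPolynomial.coeff
        (∑ a ∈ u i, Finsupp.single (Fin.castAdd h a) 1 +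
          ∑ c ∈ w j, Finsupp.single (Fin.natAdd h c) 1) F).det ≠ 0 := by
  have hr : r ≤ 2 ^ h := by
    have := Fintype.card_le_of_injective u hu
    rwa [Fintype.card_fin, Fintype.card_finset, Fintype.card_fin] at this
  exact partitionMinor_hit_of_le_quartic h r hh (hr.trans (two_pow_le_quartic h (by omega) h21)) u w hu hw

/-- The node body for every `r ≤ 2^h` when `1 ≤ h ≤ 21`. -/
theorem simplexUniversal_upto_twentyone (h : ℕ) (h1 : 1 ≤ h) (h21 : h ≤ 21) (r : ℕ) (hr : r ≤ 2 ^ h) :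
    ∃ (m D N : ℕ) (S : Fin m → Fin D → Finset (Fin N)) (e : Fin r → Fin m × (Fin D → Option (Fin N))),
      m ≤ (h + h) ^ 2 ∧ D ≤ h + h ∧ N ≤ (h + h) ^ 2 ∧ Function.Injective e ∧
      (∀ c : Fin m × (Fin D → Option (Fin N)),
        c ∈ Set.range e ↔ ∀ (f : Fin D) (j : Fin N), c.2 f = some j → j ∈ S c.1 f) ∧
      ∀ u : Fin r → Finset (Fin h), Function.Injective u →
        ∃ tx : Fin m → Option (Fin D × Fin N) → Fin h → ℂ,
          (Matrix.of fun i k : Fin r => ∏ a ∈ u i,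
            (tx (e k).1 none a + ∑ f : Fin D, ((e k).2 f).elim 0 fun j => tx (e k).1 (some (f, j)) a)).det ≠ 0 :=
  simplexUniversal_of_le_quartic h r (hr.trans (two_pow_le_quartic h h1 h21))

end

end Summit.ValiantsHypothesis.ValiantsHypothesis.Theorems.BarrierLever.SimplexJoin
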